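import Summits.BirchSwinnertonDyer.BirchSwinnertonDyer.Theses.SmallImageMuTransfer
import Summits.BirchSwinnertonDyer.BirchSwinnertonDyer.Theorems.Rank1ResidualX9MuTransfer
import Literature.NumberTheory.EllipticCurves.EmertonPollackWeston2006.MuAnTransferGoodOrdinary
import Literature.NumberTheory.EllipticCurves.GreenbergVatsal2000.CongruentCurves
import Literature.NumberTheory.EllipticCurves.ComplexMultiplication
import Literature.NumberTheory.EllipticCurves.ModularCurvePeriodRatio
import HarnessLib

/-!
# Route `SmallImageMuTransfer` (rung K6, leaf `BSDpOnClassX9`), crux `AnalyticMuZeroX9`: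
# the GLUE item `AnalyticMuZeroX9Split` of the glued split D1 — `AnalyticMuZeroX9 ⟸ (μ = 0 for the
# CM curves) ∧ (the certificate off the CM-partnered pairs) ∧ (three published inputs)` — PROVED

HONEST FRAMING (cell `b2b-bsdres`, X9 prover lineage; verbatim): the cell deletes COMBINATION-SHAPED
residual classes of the rank-≤1 BSD formula from PUBLISHED theorems only and TYPES the
construction-shaped remainder; this is not "finishing BSD".  Nothing below asserts anything about
any curve beyond what the kernel proves; class X9 stays TYPED at class level; no pair, count, mark or
tier word moves.  The theorem is a CONDITIONAL composition: it credits nothing toward closure.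

Closing file for the GLUE item `AnalyticMuZeroX9Split` (stmt-BirchSwinnertonDyer-19237, support,
rank 304) of the DRAFT route `Theses/SmallImageMuTransfer.lean` (cell `bsd-smallim`, rev 4, commit
8017ec1b).  The route's tenure planner (seat `bsd-smallim-plan`, memo `plan/k6/PLAN-K6-v1.md` §2.3,
package `plan/k6/split/`, split applied 2026-08-26T02:30Z) SPLIT the crux `AnalyticMuZeroX9`
(stmt-BirchSwinnertonDyer-19630, = `Rank1Residual.AnalyticMuZeroOnClassX9`) into

* D1a `MuZeroCMCurves` (crux): Greenberg's `μ = 0`, analytic side and `ϖ`-normalised, for the CM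
  elliptic curves over `ℚ` (`j` among the thirteen class-number-one invariants) at every good
  ordinary prime `p ≥ 5` with `A[p]` irreducible — OPEN class-wide (the cyclotomic line of Katz's
  two-variable measure is not in print), a finite certificate per curve;
* D1b `AnalyticMuZeroX9NoCMPartner` (crux): the unit-coefficient certificate on the X9 pairs WITHOUT
  a CM elliptic-curve partner `A` (`A[p] ≃ W[p]` `Γ_ℚ`-equivariantly) — OPEN;
* D1c `MuSplitInputs` (support, cite-only): Emerton–Pollack–Weston 2006 Thm. 1 (analytic `μ`
  transfers along `A[p] ≃ W[p]` at good ordinary `p ≥ 5`, tree fact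
  `EmertonPollackWeston2006.thm1_muAn_transfer_of_torsionIso`), the period unit
  `Ω_E = u · Ω⁺_f`, `|u|_p = 1` at irreducible `p ≥ 5` (`realPeriodRat_eq_unit_mul_plusPeriod`), and
  Carayol's level = conductor (`IsNewformOf.level_eq_conductorNorm`),

(items stmt-BirchSwinnertonDyer-19234 / 19235 / 19236) with the glue item
`AnalyticMuZeroX9Split : MuZeroCMCurves → AnalyticMuZeroX9NoCMPartner → MuSplitInputs →
AnalyticMuZeroX9` (stmt-BirchSwinnertonDyer-19237).  This file closes the glue item:

* `Rank1Residual.analyticMuZeroOnClassX9_of_cmSplit` — the seam over the SIGNATURES: its three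
  hypotheses are VERBATIM the three child statements (`plan/k6/split/children.json`, sha16
  20b990975f1d0c34 = the route file's `MuZeroCMCurves` / `AnalyticMuZeroX9NoCMPartner` /
  `MuSplitInputs` bodies; fully qualified, the CM-partner predicate inlined) and its conclusion is
  the parent's signature `Rank1Residual.AnalyticMuZeroOnClassX9` (the route decl
  `Theses.SmallImageMuTransfer.AnalyticMuZeroX9` is by definition a copy of it);
* `Theorems.smallImageMuTransfer_AnalyticMuZeroX9Split_proof :
  Theses.SmallImageMuTransfer.AnalyticMuZeroX9Split` — literally the route decl, by `intro` and
  the seam (the children are `def`s whose bodies are the seam's hypotheses).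

The proof is the planner's (`plan/k6/split/SplitMu.lean::analyticMuZeroX9_of_split`, sha16
4ce041deed07a876, farm rc 0, written against a scratch copy of the children), ported to the
rendered route decls: by cases on a CM partner `A`; with a partner, irreducibility of `A[p]` is
that of `W[p]` transported along `e⁻¹` (`GreenbergVatsal2000.hasIrreducibleModPGaloisRep_of_torsionIso`),
D1a gives the `ϖ`-normalised certificate for `A`, EPW Thm. 1 moves it to `W` (Carayol puts `f` at
level `N_W`), and the period unit removes `ϖ`; without a partner it is D1b verbatim.  A glue
proof closes a bookkeeping item only: the mathematical content of the crux is now exactly the two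
child cruxes 19234 (OPEN) and 19235 (OPEN) plus the cite-only support 19236; class X9 stays TYPED.

(X9 prover GEN 39, 2026-08-26; `--workitem stmt-BirchSwinnertonDyer-19237`.)
-/

-- the summit and its single problem are both named `BirchSwinnertonDyer` (registry layout D-0017)
set_option linter.dupNamespace false

set_option autoImplicit false

noncomputable section

open scoped Classical MatrixGroups ModularForm

open CongruenceSubgroup WeierstrassCurve Literature.NumberTheory.EllipticCurves
  Literature.NumberTheory.EllipticCurves.ModularForms
  Literature.NumberTheory.EllipticCurves.GreenbergVatsal2000

namespace Summit.BirchSwinnertonDyer.BirchSwinnertonDyer.Rank1Residual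

/-- **The seam of the glued split D1 of crux `AnalyticMuZeroX9`, PROVED over the item's
signature.**  Hypotheses, verbatim the planned children (`plan/k6/split/children.json`):
`h1` = D1a `MuZeroCMCurves` (Greenberg's analytic `μ = 0`, `ϖ`-normalised, for the CM elliptic
curves over `ℚ` with `j ∈ maximalCMJInvariants` at good ordinary `p ≥ 5` with `A[p]` irreducible —
OPEN), `h2` = D1b `AnalyticMuZeroX9NoCMPartner` (the unit-coefficient certificate on the X9 pairs
without a CM elliptic-curve partner — OPEN), `h3` = D1c `MuSplitInputs` (EPW 2006 Thm. 1 ∧ the period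
unit at irreducible `p ≥ 5` ∧ Carayol — PUBLISHED, cite-only named facts).  Conclusion:
`AnalyticMuZeroOnClassX9` (= item 19630's signature).  Proof (the planner's, ported): by cases on a
CM partner `A` of `(W, p)`; yes ⇒ `A[p]` irreducible along `e⁻¹`, Carayol pins the level of `f` to
`N_W`, the period unit `u` of `W` gives `ϖ := u⁻¹` with `ϖ·Ω_W = Ω⁺_f`, D1a at `(A, p)` in the
`∀ fA ∀ ϖ_A` shape EPW consumes, EPW transports the `ϖ`-normalised unit coefficient to `(W, f)`,
and `‖u⁻¹‖ = 1` drops `ϖ`; no ⇒ D1b.  CONDITIONAL composition — credits nothing toward closure.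
[cite: EmertonPollackWeston2006, Thm. 1 (arXiv:math/0404484 p. 2)]
[cite: GreenbergVatsal2000, Rem. 3.4] -/
theorem analyticMuZeroOnClassX9_of_cmSplit
    (h1 : ∀ (A : WeierstrassCurve ℚ) [A.IsElliptic] [A.IsGloballyMinimal] (p : ℕ) [Fact p.Prime],
      5 ≤ p → A.j ∈ Literature.NumberTheory.EllipticCurves.maximalCMJInvariants →
      A.HasGoodReductionAtPrime p → ¬ (p : ℤ) ∣ A.frobeniusTrace p →
      A.HasIrreducibleModPGaloisRep p →
      ∀ [NeZero (A.conductorNorm ℤ)]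
        (fA : CuspForm (CongruenceSubgroup.Gamma0 (A.conductorNorm ℤ)) 2),
        Literature.NumberTheory.EllipticCurves.ModularForms.IsNewformOf A fA → ∀ (ϖ : ℚ),
        (ϖ : ℝ) * A.realPeriodRat = Literature.NumberTheory.EllipticCurves.ModularForms.plusPeriod fA →
        ∃ n : ℕ, ‖PowerSeries.coeff n (PowerSeries.C (ϖ : ℚ_[p]) *
          Literature.NumberTheory.EllipticCurves.padicLFunction fA
            (Literature.NumberTheory.EllipticCurves.unitRoot A p : ℚ_[p]))‖ = 1)
    (h2 : ∀ (W : WeierstrassCurve ℚ) [W.IsElliptic] [W.IsGloballyMinimal] (p : ℕ) [Fact p.Prime]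
      {N : ℕ} [NeZero N] (f : CuspForm (CongruenceSubgroup.Gamma0 N) 2),
      Summit.BirchSwinnertonDyer.BirchSwinnertonDyer.Rank1Residual.ClassX9 W p →
      ¬ (∃ (A : WeierstrassCurve ℚ) (_ : A.IsElliptic) (_ : A.IsGloballyMinimal),
          A.j ∈ Literature.NumberTheory.EllipticCurves.maximalCMJInvariants ∧
          A.HasGoodReductionAtPrime p ∧ ¬ (p : ℤ) ∣ A.frobeniusTrace p ∧
          ∃ e : WeierstrassCurve.geomTorsion A (p : ℤ) ≃+ WeierstrassCurve.geomTorsion W (p : ℤ),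
            ∀ (σ : Field.absoluteGaloisGroup ℚ) (P : WeierstrassCurve.geomTorsion A (p : ℤ)),
              e (σ • P) = σ • e P) →
      Literature.NumberTheory.EllipticCurves.ModularForms.IsNewformOf W f →
      ∃ n : ℕ, ‖PowerSeries.coeff n (Literature.NumberTheory.EllipticCurves.padicLFunction f
        (Literature.NumberTheory.EllipticCurves.unitRoot W p : ℚ_[p]))‖ = 1)
    (h3 : Literature.NumberTheory.EllipticCurves.EmertonPollackWeston2006.thm1_muAn_transfer_of_torsionIso ∧
      Literature.NumberTheory.EllipticCurves.realPeriodRat_eq_unit_mul_plusPeriod ∧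
      (∀ (N : ℕ) [NeZero N],
        Literature.NumberTheory.EllipticCurves.ModularForms.IsNewformOf.level_eq_conductorNorm (N := N))) :
    AnalyticMuZeroOnClassX9 := by
  obtain ⟨hEPW, hA25, hCar⟩ := h3
  unfold AnalyticMuZeroOnClassX9
  intro W _ _ p _ N _ f hX9 hf
  by_cases hP : ∃ (A : WeierstrassCurve ℚ) (_ : A.IsElliptic) (_ : A.IsGloballyMinimal),
      A.j ∈ Literature.NumberTheory.EllipticCurves.maximalCMJInvariants ∧
      A.HasGoodReductionAtPrime p ∧ ¬ (p : ℤ) ∣ A.frobeniusTrace p ∧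
      ∃ e : WeierstrassCurve.geomTorsion A (p : ℤ) ≃+ WeierstrassCurve.geomTorsion W (p : ℤ),
        ∀ (σ : Field.absoluteGaloisGroup ℚ) (P : WeierstrassCurve.geomTorsion A (p : ℤ)),
          e (σ • P) = σ • e P
  · obtain ⟨A, hAE, hAM, hjA, hgoodA, hordA, e, he⟩ := hP
    obtain ⟨-, h5, hgood, hord, hirr, -⟩ := hX9
    -- the inverse isomorphism is equivariant as well
    have he' : ∀ (σ : Field.absoluteGaloisGroup ℚ) (Q : geomTorsion W (p : ℤ)),
        e.symm (σ • Q) = σ • e.symm Q := by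
      intro σ Q
      apply e.injective
      rw [e.apply_symm_apply, he, e.apply_symm_apply]
    have hirrA : A.HasIrreducibleModPGaloisRep p :=
      hasIrreducibleModPGaloisRep_of_torsionIso e.symm he' hirr
    -- Carayol: the newform of `W` lives at level `N_W`
    have hN : N = W.conductorNorm ℤ := hCar N hf
    subst hN
    -- the period unit for `W`
    obtain ⟨u, hu, hΩ⟩ := hA25 W p h5 hgood hirr f hf
    have hu0 : (u : ℚ_[p]) ≠ 0 := by
      intro h0
      rw [h0, norm_zero] at hu
      exact zero_ne_one hu
    have hu0' : u ≠ 0 := by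
      intro h0
      exact hu0 (by rw [h0]; push_cast; rfl)
    have hϖ : ((u⁻¹ : ℚ) : ℝ) * W.realPeriodRat = plusPeriod f := by
      rw [hΩ]
      push_cast
      rw [← mul_assoc, inv_mul_cancel₀ (by exact_mod_cast hu0'), one_mul]
    -- D1a at the partner, in the shape EPW consumes
    have hμA : ∀ [NeZero (A.conductorNorm ℤ)] (fA : CuspForm (Gamma0 (A.conductorNorm ℤ)) 2),
        IsNewformOf A fA → ∀ (ϖ : ℚ), (ϖ : ℝ) * A.realPeriodRat = plusPeriod fA →
        ∃ n : ℕ, ‖PowerSeries.coeff n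
          (PowerSeries.C (ϖ : ℚ_[p]) * padicLFunction fA (unitRoot A p : ℚ_[p]))‖ = 1 := by
      intro _ fA hfA ϖ hϖA
      exact h1 A p h5 hjA hgoodA hordA hirrA fA hfA ϖ hϖA
    obtain ⟨n, hn⟩ :=
      hEPW A W p h5 hgoodA hordA hgood hord ⟨e, he⟩ hirrA hμA f hf (u⁻¹ : ℚ) hϖ
    refine ⟨n, ?_⟩
    have hnorm : ‖((u⁻¹ : ℚ) : ℚ_[p])‖ = 1 := by
      push_cast
      rw [norm_inv, hu, inv_one]
    rw [PowerSeries.coeff_C_mul, norm_mul, hnorm, one_mul] at hn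
    exact hn
  · exact h2 W p f hX9 hP hf

end Summit.BirchSwinnertonDyer.BirchSwinnertonDyer.Rank1Residual


namespace Summit.BirchSwinnertonDyer.BirchSwinnertonDyer.Theorems

/-- **GLUE item `AnalyticMuZeroX9Split` (stmt-BirchSwinnertonDyer-19237), PROVED — literally the
route decl `Theses.SmallImageMuTransfer.AnalyticMuZeroX9Split :
MuZeroCMCurves → AnalyticMuZeroX9NoCMPartner → MuSplitInputs → AnalyticMuZeroX9`.**  The three
children are `def`s of the route file whose bodies are, verbatim, the hypotheses of
`Rank1Residual.analyticMuZeroOnClassX9_of_cmSplit`, and the parent `AnalyticMuZeroX9` is by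
definition `Rank1Residual.AnalyticMuZeroOnClassX9`; so the glue is that seam after `unfold`.
Bookkeeping only: the crux's content is now the two child cruxes (both OPEN) + the cite-only
support; nothing about any curve is asserted, class X9 stays TYPED.
[cite: EmertonPollackWeston2006, Thm. 1 (arXiv:math/0404484 p. 2)] -/
theorem smallImageMuTransfer_AnalyticMuZeroX9Split_proof :
    Summit.BirchSwinnertonDyer.BirchSwinnertonDyer.Theses.SmallImageMuTransfer.AnalyticMuZeroX9Split := by
  unfold Summit.BirchSwinnertonDyer.BirchSwinnertonDyer.Theses.SmallImageMuTransfer.AnalyticMuZeroX9Split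
    Summit.BirchSwinnertonDyer.BirchSwinnertonDyer.Theses.SmallImageMuTransfer.MuZeroCMCurves
    Summit.BirchSwinnertonDyer.BirchSwinnertonDyer.Theses.SmallImageMuTransfer.AnalyticMuZeroX9NoCMPartner
    Summit.BirchSwinnertonDyer.BirchSwinnertonDyer.Theses.SmallImageMuTransfer.MuSplitInputs
    Summit.BirchSwinnertonDyer.BirchSwinnertonDyer.Theses.SmallImageMuTransfer.AnalyticMuZeroX9
  intro h1 h2 h3
  exact Summit.BirchSwinnertonDyer.BirchSwinnertonDyer.Rank1Residual.analyticMuZeroOnClassX9_of_cmSplit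
    h1 h2 h3

end Summit.BirchSwinnertonDyer.BirchSwinnertonDyer.Theorems

end
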